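import Summits.QuantumFields.QCD.Theses.HeatSlicedQuarks

/-!
# `RobustYangMillsHandover` — the STRATEGIST'S SPLIT of crux stmt-QuantumFields-8892 into three typed sub-cruxes
# (route `HeatSlicedQuarks`; glue theorem for `ledger route edit --split RobustYangMillsHandover --glue-by …`)

The crux is the bare completion arrow `RobustYangMillsHandover := ContinuumQCDExists → QCD`.  Since the statement
re-type p117723 (`QCDOf N_f` conjoins `reg.IsChiralAtZero`) thirteen lead seats and two ideation rounds have ended
at the same two unfiled, crux-sized inputs about X₀'s OWN regularisation — honest continuum data BELOW X₀'s offset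
(`stub_pinnedData`) and chirality AT the pin (`stub_wardTripleAtPin` / `OpensBelow` / `LeeYangOpenness`, each
kernel-certified EQUIVALENT to the chirality clause of the pinned regularisation) — and asked for the restatement
R1 (`HeavyHandover` + `ChiralCompletion`; FINDING-c3, FINDING-c11, TRIAGE-r2-1/2).  This file is the typed R1 with
the light half cut along its two physical MECHANISMS rather than along the pin:

* child 1 `HeavyThresholdHandover` — `ContinuumQCDExists → ThresholdQCD` (consequent = the body of
  `HeavyThresholdYMBridge.ThresholdQCD`, verbatim): X₀ hands over massive QCD WITH both gap clauses above SOME offset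
  `M₀` of SOME mass-scaling regularisation.  The pre-re-type crux; every round-1 line of this crux is a line for it.
* child 2 `GaplessPointOnMassAxis` — every regularisation that is threshold-QCD above some offset has an offset `M`
  above which the lattice rate is NOT uniform (`∀ ε > 0` some tuple above `M` is not `ε`-gapped): a gapless point
  (Goldstone pions / anomaly matching) lies on its Wilson mass axis.  A NO-gap statement.
* child 3 `GappedMassContinuation` — UNIFORM OPENNESS of gapped massive QCD in the quark-mass offset: for every
  `ε > 0` there is `δ > 0` such that wherever the lattice rate is uniformly `≥ ε` above an offset `M` and the full
  body of `QCDOf` (data, continuum gap, lattice gap) holds above `M`, the full body holds above `M − δ`.  A STABILITY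
  statement with content at every offset at which the rate `ε` is attained (the gap envelope must rise continuously
  from the bottom of the gapped region), not only at the pin.

`RobustYangMillsHandover_of_subs : child 1 → child 2 → child 3 → RobustYangMillsHandover` is order theory on `ℝ`:
let `G` be the up-set of offsets above which the body holds (non-empty by child 1) and `U` the up-set of offsets
with a uniform rate above them; child 2 gives `M₁ ∉ U`; either `G` reaches to or below `M₁` (that element of `G` is
then outside `U` — the pin), or `G` is bounded below by `M₁`, its infimum `P` lies in `G`, and `P ∈ U` would by
child 3 put `P − δ/2` into `G`: so `P ∉ U`.  At the pin the `m_crit`-shift by `P` witnesses `QCDOf N_f`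
(`qcdOf_of_pin_body`, the body form of the landed `PinnedThreshold.qcdOf_of_pinnedThreshold`, re-derived here so that
this file imports the route module only).  The children are HYPOTHESES, stated LITERALLY (fully qualified,
byte-identical with the route items to be filed).  Nothing here asserts a Theses decl.
-/

namespace Summit.QuantumFields.QCD.Theorems.RobustYangMillsHandover.Split

open Summit.QuantumFields.QCD.Theses.HeatSlicedQuarks
open Literature.MathematicalPhysics.QuantumFieldTheory

variable {Nf : ℕ}

/-! ## §0 The `m_crit`-shift and the pin lemma (body form) -/

/-- The `m_crit`-shift of a regularisation by the offset `P` (realised masses `m` ↦ offsets `P + m`). [folklore] -/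
noncomputable def shiftReg (reg : QCDRegularisation Nf) (P : ℝ) : QCDRegularisation Nf :=
  { reg with mcrit := fun k => reg.mcrit k + reg.a k * P / reg.Zm k }

/-- The shifted scheme at `m` IS the original scheme at `P + m`. [folklore] -/
theorem shiftReg_scheme (reg : QCDRegularisation Nf) (P : ℝ) (m : Fin Nf → ℝ)
    (z shift : QCDField Nf → ℕ → ℝ) :
    (shiftReg reg P).scheme m z shift = reg.scheme (fun f => P + m f) z shift := by
  simp only [shiftReg, QCDRegularisation.scheme, QCDScheme.mk.injEq, true_and, and_true]
  funext f k
  ring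

/-- The shift keeps `HasMassScaling` (which never reads `m_crit`). [folklore] -/
theorem shiftReg_hasMassScaling_iff (reg : QCDRegularisation Nf) (P : ℝ) :
    (shiftReg reg P).HasMassScaling ↔ reg.HasMassScaling :=
  Iff.rfl

/-- **`QCDOf` at a pin, body form**: a mass-scaling regularisation, an offset `P` with no uniform lattice rate just
above it, and the full body at every tuple above `P` give `QCDOf N_f` — witnessed by the `m_crit`-shift by `P`, whose
chirality clause is literally "no uniform rate just above `P`". [folklore] -/
theorem qcdOf_of_pin_body (reg : QCDRegularisation Nf) (hMS : reg.HasMassScaling) (P : ℝ)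
    (hχ : ∀ ε > (0 : ℝ), ∃ t : Fin Nf → ℝ, (∀ f, P < t f) ∧ ¬ (reg.scheme t 0 0).HasLatticeMassGap ε)
    (hG : ∀ t : Fin Nf → ℝ, (∀ f, P < t f) → (∃ (z shift : QCDField Nf → ℕ → ℝ) (T : OSData (QCDField Nf) 4), IsQCDAlong (reg.scheme t z shift) T ∧ T.IsNontrivial QCDField.glue ∧ T.IsNonGaussian QCDField.glue ∧ (∀ f g : Fin Nf, f ≠ g → T.IsNontrivial (QCDField.pseudoRe f g)) ∧ ∃ Δ > 0, T.HasMassGap Δ ∧ (reg.scheme t z shift).HasLatticeMassGap Δ)) : QCDOf Nf := by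
  refine ⟨shiftReg reg P, (shiftReg_hasMassScaling_iff reg P).mpr hMS, ?_, ?_⟩
  · -- chirality of the shifted regularisation = no uniform rate just above `P`
    intro ε hε
    obtain ⟨t, ht, hng⟩ := hχ ε hε
    refine ⟨fun f => t f - P, fun f => by linarith [ht f], ?_⟩
    rw [shiftReg_scheme]
    have ht' : (fun f => P + (t f - P)) = t := funext fun f => by ring
    rwa [ht']
  · -- the body at positive masses of the shifted regularisation = the body above `P`
    intro m hm
    obtain ⟨z, shift, T, hA, hN, hGs, hPs, Δ, hΔ, hT, hL⟩ := hG (fun f => P + m f) fun f => by linarith [hm f]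
    refine ⟨z, shift, T, ?_, hN, hGs, hPs, Δ, hΔ, hT, ?_⟩
    · rw [shiftReg_scheme]; exact hA
    · rw [shiftReg_scheme]; exact hL

/-! ## §1 The order-theoretic core -/

/-- A finite tuple strictly above `P` is above `P + δ` for some `δ > 0`. [folklore] -/
theorem exists_pos_add_le_all (P : ℝ) (t : Fin Nf → ℝ) (ht : ∀ f, P < t f) :
    ∃ δ > (0 : ℝ), ∀ f, P + δ ≤ t f := by
  rcases isEmpty_or_nonempty (Fin Nf) with hE | hN
  · exact ⟨1, one_pos, fun f => (hE.false f).elim⟩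
  · obtain ⟨f₀, -, hf₀⟩ := Finset.exists_min_image Finset.univ t Finset.univ_nonempty
    exact ⟨t f₀ - P, by linarith [ht f₀], fun f => by linarith [hf₀ f (Finset.mem_univ f)]⟩

/-- **The order-theoretic core.**  For one regularisation: if the set `G` of offsets above which the body holds is
non-empty (heavy threshold), some offset `M₁` has no uniform rate above it (gapless point), and a uniform rate above
an element `M` of `G` continues the body below `M` (continuation), then some `P ∈ G` has no uniform rate above it.
[folklore] -/
theorem exists_pin_of_threshold_gapless_continuation (reg : QCDRegularisation Nf)
    (hne : ∃ M₀ : ℝ, ∀ t : Fin Nf → ℝ, (∀ f, M₀ < t f) → (∃ (z shift : QCDField Nf → ℕ → ℝ) (T : OSData (QCDField Nf) 4), IsQCDAlong (reg.scheme t z shift) T ∧ T.IsNontrivial QCDField.glue ∧ T.IsNonGaussian QCDField.glue ∧ (∀ f g : Fin Nf, f ≠ g → T.IsNontrivial (QCDField.pseudoRe f g)) ∧ ∃ Δ > 0, T.HasMassGap Δ ∧ (reg.scheme t z shift).HasLatticeMassGap Δ))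
    (hgap : ∃ M₁ : ℝ, ∀ ε > (0 : ℝ), ∃ t : Fin Nf → ℝ, (∀ f, M₁ < t f) ∧ ¬ (reg.scheme t 0 0).HasLatticeMassGap ε)
    (hcont : ∀ M : ℝ, (∃ ε > (0 : ℝ), ∀ t : Fin Nf → ℝ, (∀ f, M < t f) → (reg.scheme t 0 0).HasLatticeMassGap ε) →
      (∀ t : Fin Nf → ℝ, (∀ f, M < t f) → (∃ (z shift : QCDField Nf → ℕ → ℝ) (T : OSData (QCDField Nf) 4), IsQCDAlong (reg.scheme t z shift) T ∧ T.IsNontrivial QCDField.glue ∧ T.IsNonGaussian QCDField.glue ∧ (∀ f g : Fin Nf, f ≠ g → T.IsNontrivial (QCDField.pseudoRe f g)) ∧ ∃ Δ > 0, T.HasMassGap Δ ∧ (reg.scheme t z shift).HasLatticeMassGap Δ)) →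
        ∃ δ > (0 : ℝ), ∀ t : Fin Nf → ℝ, (∀ f, M - δ < t f) → (∃ (z shift : QCDField Nf → ℕ → ℝ) (T : OSData (QCDField Nf) 4), IsQCDAlong (reg.scheme t z shift) T ∧ T.IsNontrivial QCDField.glue ∧ T.IsNonGaussian QCDField.glue ∧ (∀ f g : Fin Nf, f ≠ g → T.IsNontrivial (QCDField.pseudoRe f g)) ∧ ∃ Δ > 0, T.HasMassGap Δ ∧ (reg.scheme t z shift).HasLatticeMassGap Δ)) :
    ∃ P : ℝ, (∀ t : Fin Nf → ℝ, (∀ f, P < t f) → (∃ (z shift : QCDField Nf → ℕ → ℝ) (T : OSData (QCDField Nf) 4), IsQCDAlong (reg.scheme t z shift) T ∧ T.IsNontrivial QCDField.glue ∧ T.IsNonGaussian QCDField.glue ∧ (∀ f g : Fin Nf, f ≠ g → T.IsNontrivial (QCDField.pseudoRe f g)) ∧ ∃ Δ > 0, T.HasMassGap Δ ∧ (reg.scheme t z shift).HasLatticeMassGap Δ)) ∧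
      ∀ ε > (0 : ℝ), ∃ t : Fin Nf → ℝ, (∀ f, P < t f) ∧ ¬ (reg.scheme t 0 0).HasLatticeMassGap ε := by
  set G : Set ℝ := {M | ∀ t : Fin Nf → ℝ, (∀ f, M < t f) → (∃ (z shift : QCDField Nf → ℕ → ℝ) (T : OSData (QCDField Nf) 4), IsQCDAlong (reg.scheme t z shift) T ∧ T.IsNontrivial QCDField.glue ∧ T.IsNonGaussian QCDField.glue ∧ (∀ f g : Fin Nf, f ≠ g → T.IsNontrivial (QCDField.pseudoRe f g)) ∧ ∃ Δ > 0, T.HasMassGap Δ ∧ (reg.scheme t z shift).HasLatticeMassGap Δ)} with hGdef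
  obtain ⟨M₀, hM₀⟩ := hne
  obtain ⟨M₁, hM₁⟩ := hgap
  have hM₀G : M₀ ∈ G := hM₀
  by_cases hlow : ∃ P ∈ G, P ≤ M₁
  · -- an element of `G` at or below `M₁`: no uniform rate above it either
    obtain ⟨P, hPG, hPM⟩ := hlow
    refine ⟨P, hPG, fun ε hε => ?_⟩
    obtain ⟨t, ht, hng⟩ := hM₁ ε hε
    exact ⟨t, fun f => lt_of_le_of_lt hPM (ht f), hng⟩
  · -- `G` is bounded below by `M₁`; work at its infimum
    push Not at hlow
    have hbdd : BddBelow G := ⟨M₁, fun P hP => (hlow P hP).le⟩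
    have hGne : G.Nonempty := ⟨M₀, hM₀G⟩
    set P := sInf G with hP
    have hPG : P ∈ G := by
      intro t ht
      obtain ⟨δ, hδ, hδt⟩ := exists_pos_add_le_all P t ht
      obtain ⟨M, hMG, hMlt⟩ := exists_lt_of_csInf_lt hGne (show P < P + δ by linarith)
      exact hMG t fun f => by linarith [hδt f]
    refine ⟨P, hPG, ?_⟩
    by_contra hU
    push Not at hU
    obtain ⟨ε, hε, hUε⟩ := hU
    obtain ⟨δ, hδ, hcontP⟩ := hcont P ⟨ε, hε, hUε⟩ hPG
    have hmem : P - δ / 2 ∈ G := fun t ht => hcontP t fun f => by linarith [ht f]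
    have := csInf_le hbdd hmem
    linarith

/-! ## §2 The split theorem -/

/-- **`QCDOf N_f` for `N_f ∈ {2,3}` from the three children and X₀** — the common body of the two crux-concluding
theorems below (stated with the children as explicit hypotheses, fully qualified, byte-identical with the route items to
be filed). [folklore] -/
theorem qcdOf_of_subs
    (h₁ : ContinuumQCDExists → ∀ Nf : ℕ, Nf = 2 ∨ Nf = 3 → ∃ M₀ : ℝ, 0 ≤ M₀ ∧ ∃ reg : Literature.MathematicalPhysics.QuantumFieldTheory.QCDRegularisation Nf, reg.HasMassScaling ∧ ∀ m : Fin Nf → ℝ, (∀ f, M₀ < m f) → ∃ (z shift : Literature.MathematicalPhysics.QuantumFieldTheory.QCDField Nf → ℕ → ℝ) (T : Literature.MathematicalPhysics.QuantumFieldTheory.OSData (Literature.MathematicalPhysics.QuantumFieldTheory.QCDField Nf) 4), Literature.MathematicalPhysics.QuantumFieldTheory.IsQCDAlong (reg.scheme m z shift) T ∧ T.IsNontrivial Literature.MathematicalPhysics.QuantumFieldTheory.QCDField.glue ∧ T.IsNonGaussian Literature.MathematicalPhysics.QuantumFieldTheory.QCDField.glue ∧ (∀ f g : Fin Nf, f ≠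 g → T.IsNontrivial (Literature.MathematicalPhysics.QuantumFieldTheory.QCDField.pseudoRe f g)) ∧ ∃ Δ > 0, T.HasMassGap Δ ∧ (reg.scheme m z shift).HasLatticeMassGap Δ)
    (h₂ : ∀ Nf : ℕ, Nf = 2 ∨ Nf = 3 → ∀ reg : Literature.MathematicalPhysics.QuantumFieldTheory.QCDRegularisation Nf, reg.HasMassScaling → (∃ M₀ : ℝ, ∀ m : Fin Nf → ℝ, (∀ f, M₀ < m f) → ∃ (z shift : Literature.MathematicalPhysics.QuantumFieldTheory.QCDField Nf → ℕ → ℝ) (T : Literature.MathematicalPhysics.QuantumFieldTheory.OSData (Literature.MathematicalPhysics.QuantumFieldTheory.QCDField Nf) 4), Literature.MathematicalPhysics.QuantumFieldTheory.IsQCDAlong (reg.scheme m z shift) T ∧ T.IsNontrivial Literature.MathematicalPhysics.QuantumFieldTheory.QCDField.glue ∧ T.IsNonGaussian Literature.MathematicalPhysics.QuantumFieldTheory.QCDField.glue ∧ (∀ f g : Fin Nf, f ≠ g → T.IsNontrivial (Literature.MathematicalPhysics.QuantumFieldTheory.QCDField.pseudoRe f g)) ∧ ∃ Δ > 0, T.HasMassGap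 Δ ∧ (reg.scheme m z shift).HasLatticeMassGap Δ) → ∃ M : ℝ, ∀ ε : ℝ, 0 < ε → ∃ m : Fin Nf → ℝ, (∀ f, M < m f) ∧ ¬ (reg.scheme m 0 0).HasLatticeMassGap ε)
    (h₃ : ∀ Nf : ℕ, Nf = 2 ∨ Nf = 3 → ∀ reg : Literature.MathematicalPhysics.QuantumFieldTheory.QCDRegularisation Nf, reg.HasMassScaling → ∀ ε : ℝ, 0 < ε → ∃ δ : ℝ, 0 < δ ∧ ∀ M : ℝ, (∀ m : Fin Nf → ℝ, (∀ f, M < m f) → (reg.scheme m 0 0).HasLatticeMassGap ε) → (∀ m : Fin Nf → ℝ, (∀ f, M < m f) → ∃ (z shift : Literature.MathematicalPhysics.QuantumFieldTheory.QCDField Nf → ℕ → ℝ) (T : Literature.MathematicalPhysics.QuantumFieldTheory.OSData (Literature.MathematicalPhysics.QuantumFieldTheory.QCDField Nf) 4), Literature.MathematicalPhysics.QuantumFieldTheory.IsQCDAlong (reg.scheme m z shift) T ∧ T.IsNontrivial Literature.MathematicalPhysics.QuantumFieldTheory.QCDField.glue ∧ T.IsNonGaussian Literature.MathematicalPhysics.QuantumFieldTheory.QCDField.glue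 ∧ (∀ f g : Fin Nf, f ≠ g → T.IsNontrivial (Literature.MathematicalPhysics.QuantumFieldTheory.QCDField.pseudoRe f g)) ∧ ∃ Δ > 0, T.HasMassGap Δ ∧ (reg.scheme m z shift).HasLatticeMassGap Δ) → ∀ m : Fin Nf → ℝ, (∀ f, M - δ < m f) → ∃ (z shift : Literature.MathematicalPhysics.QuantumFieldTheory.QCDField Nf → ℕ → ℝ) (T : Literature.MathematicalPhysics.QuantumFieldTheory.OSData (Literature.MathematicalPhysics.QuantumFieldTheory.QCDField Nf) 4), Literature.MathematicalPhysics.QuantumFieldTheory.IsQCDAlong (reg.scheme m z shift) T ∧ T.IsNontrivial Literature.MathematicalPhysics.QuantumFieldTheory.QCDField.glue ∧ T.IsNonGaussian Literature.MathematicalPhysics.QuantumFieldTheory.QCDField.glue ∧ (∀ f g : Fin Nf, f ≠ g → T.IsNontrivial (Literature.MathematicalPhysics.QuantumFieldTheory.QCDField.pseudoRe f g)) ∧ ∃ Δ > 0, T.HasMassGap Δ ∧ (reg.scheme m z shift).HasLatticeMassGap Δ)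
    (hX : ContinuumQCDExists) : ∀ Nf : ℕ, Nf = 2 ∨ Nf = 3 → QCDOf Nf := by
  intro Nf hNf
  obtain ⟨M₀, -, reg, hMS, hB⟩ := h₁ hX Nf hNf
  have hne : ∃ M₀ : ℝ, ∀ t : Fin Nf → ℝ, (∀ f, M₀ < t f) → (∃ (z shift : QCDField Nf → ℕ → ℝ) (T : OSData (QCDField Nf) 4), IsQCDAlong (reg.scheme t z shift) T ∧ T.IsNontrivial QCDField.glue ∧ T.IsNonGaussian QCDField.glue ∧ (∀ f g : Fin Nf, f ≠ g → T.IsNontrivial (QCDField.pseudoRe f g)) ∧ ∃ Δ > 0, T.HasMassGap Δ ∧ (reg.scheme t z shift).HasLatticeMassGap Δ) := ⟨M₀, hB⟩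
  have hgap : ∃ M₁ : ℝ, ∀ ε > (0 : ℝ), ∃ t : Fin Nf → ℝ, (∀ f, M₁ < t f) ∧
      ¬ (reg.scheme t 0 0).HasLatticeMassGap ε := by
    obtain ⟨M₁, hM₁⟩ := h₂ Nf hNf reg hMS hne
    exact ⟨M₁, fun ε hε => hM₁ ε hε⟩
  have hcont : ∀ M : ℝ, (∃ ε > (0 : ℝ), ∀ t : Fin Nf → ℝ, (∀ f, M < t f) →
      (reg.scheme t 0 0).HasLatticeMassGap ε) →
      (∀ t : Fin Nf → ℝ, (∀ f, M < t f) → (∃ (z shift : QCDField Nf → ℕ → ℝ) (T : OSData (QCDField Nf) 4), IsQCDAlong (reg.scheme t z shift) T ∧ T.IsNontrivial QCDField.glue ∧ T.IsNonGaussian QCDField.glue ∧ (∀ f g : Fin Nf, f ≠ g → T.IsNontrivial (QCDField.pseudoRe f g)) ∧ ∃ Δ > 0, T.HasMassGap Δ ∧ (reg.scheme t z shift).HasLatticeMassGap Δ)) →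
        ∃ δ > (0 : ℝ), ∀ t : Fin Nf → ℝ, (∀ f, M - δ < t f) → (∃ (z shift : QCDField Nf → ℕ → ℝ) (T : OSData (QCDField Nf) 4), IsQCDAlong (reg.scheme t z shift) T ∧ T.IsNontrivial QCDField.glue ∧ T.IsNonGaussian QCDField.glue ∧ (∀ f g : Fin Nf, f ≠ g → T.IsNontrivial (QCDField.pseudoRe f g)) ∧ ∃ Δ > 0, T.HasMassGap Δ ∧ (reg.scheme t z shift).HasLatticeMassGap Δ) := by
    rintro M ⟨ε, hε, hUε⟩ hGM
    obtain ⟨δ, hδ, hδall⟩ := h₃ Nf hNf reg hMS ε hε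
    exact ⟨δ, hδ, hδall M hUε hGM⟩
  obtain ⟨P, hPG, hχ⟩ := exists_pin_of_threshold_gapless_continuation reg hne hgap hcont
  exact qcdOf_of_pin_body reg hMS P hχ hPG

/-- **The split** — `HeavyThresholdHandover → GaplessPointOnMassAxis → GappedMassContinuation →
RobustYangMillsHandover`, the three children as explicit hypotheses (fully qualified, byte-identical with the route
items), the crux BY NAME.  Pure logic over the tree's definitions plus the order-theoretic core; X₀ is consumed
once, by child 1. [folklore] -/
theorem RobustYangMillsHandover_of_subs
    (h₁ : ContinuumQCDExists → ∀ Nf : ℕ, Nf = 2 ∨ Nf = 3 → ∃ M₀ : ℝ, 0 ≤ M₀ ∧ ∃ reg : Literature.MathematicalPhysics.QuantumFieldTheory.QCDRegularisation Nf, reg.HasMassScaling ∧ ∀ m : Fin Nf → ℝ, (∀ f, M₀ < m f) → ∃ (z shift : Literature.MathematicalPhysics.QuantumFieldTheory.QCDField Nf → ℕ → ℝ) (T : Literature.MathematicalPhysics.QuantumFieldTheory.OSData (Literature.MathematicalPhysics.QuantumFieldTheory.QCDField Nf) 4), Literature.MathematicalPhysics.QuantumFieldTheory.IsQCDAlong (reg.scheme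 m z shift) T ∧ T.IsNontrivial Literature.MathematicalPhysics.QuantumFieldTheory.QCDField.glue ∧ T.IsNonGaussian Literature.MathematicalPhysics.QuantumFieldTheory.QCDField.glue ∧ (∀ f g : Fin Nf, f ≠ g → T.IsNontrivial (Literature.MathematicalPhysics.QuantumFieldTheory.QCDField.pseudoRe f g)) ∧ ∃ Δ > 0, T.HasMassGap Δ ∧ (reg.scheme m z shift).HasLatticeMassGap Δ)
    (h₂ : ∀ Nf : ℕ, Nf = 2 ∨ Nf = 3 → ∀ reg : Literature.MathematicalPhysics.QuantumFieldTheory.QCDRegularisation Nf, reg.HasMassScaling → (∃ M₀ : ℝ, ∀ m : Fin Nf → ℝ, (∀ f, M₀ < m f) → ∃ (z shift : Literature.MathematicalPhysics.QuantumFieldTheory.QCDField Nf → ℕ → ℝ) (T : Literature.MathematicalPhysics.QuantumFieldTheory.OSData (Literature.MathematicalPhysics.QuantumFieldTheory.QCDField Nf) 4), Literature.MathematicalPhysics.QuantumFieldTheory.IsQCDAlong (reg.scheme m z shift) T ∧ T.IsNontrivial Literature.MathematicalPhysics.QuantumFieldTheory.QCDField.glue ∧ T.IsNonGaussian Literature.MathematicalPhysics.QuantumFieldTheory.QCDField.glue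 ∧ (∀ f g : Fin Nf, f ≠ g → T.IsNontrivial (Literature.MathematicalPhysics.QuantumFieldTheory.QCDField.pseudoRe f g)) ∧ ∃ Δ > 0, T.HasMassGap Δ ∧ (reg.scheme m z shift).HasLatticeMassGap Δ) → ∃ M : ℝ, ∀ ε : ℝ, 0 < ε → ∃ m : Fin Nf → ℝ, (∀ f, M < m f) ∧ ¬ (reg.scheme m 0 0).HasLatticeMassGap ε)
    (h₃ : ∀ Nf : ℕ, Nf = 2 ∨ Nf = 3 → ∀ reg : Literature.MathematicalPhysics.QuantumFieldTheory.QCDRegularisation Nf, reg.HasMassScaling → ∀ ε : ℝ, 0 < ε → ∃ δ : ℝ, 0 < δ ∧ ∀ M : ℝ, (∀ m : Fin Nf → ℝ, (∀ f, M < m f) → (reg.scheme m 0 0).HasLatticeMassGap ε) → (∀ m : Fin Nf → ℝ, (∀ f, M < m f) → ∃ (z shift : Literature.MathematicalPhysics.QuantumFieldTheory.QCDField Nf → ℕ → ℝ) (T : Literature.MathematicalPhysics.QuantumFieldTheory.OSData (Literature.MathematicalPhysics.QuantumFieldTheory.QCDField Nf) 4), Literature.MathematicalPhysics.QuantumFieldTheory.IsQCDAlong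 (reg.scheme m z shift) T ∧ T.IsNontrivial Literature.MathematicalPhysics.QuantumFieldTheory.QCDField.glue ∧ T.IsNonGaussian Literature.MathematicalPhysics.QuantumFieldTheory.QCDField.glue ∧ (∀ f g : Fin Nf, f ≠ g → T.IsNontrivial (Literature.MathematicalPhysics.QuantumFieldTheory.QCDField.pseudoRe f g)) ∧ ∃ Δ > 0, T.HasMassGap Δ ∧ (reg.scheme m z shift).HasLatticeMassGap Δ) → ∀ m : Fin Nf → ℝ, (∀ f, M - δ < m f) → ∃ (z shift : Literature.MathematicalPhysics.QuantumFieldTheory.QCDField Nf → ℕ → ℝ) (T : Literature.MathematicalPhysics.QuantumFieldTheory.OSData (Literature.MathematicalPhysics.QuantumFieldTheory.QCDField Nf) 4), Literature.MathematicalPhysics.QuantumFieldTheory.IsQCDAlong (reg.scheme m z shift) T ∧ T.IsNontrivial Literature.MathematicalPhysics.QuantumFieldTheory.QCDField.glue ∧ T.IsNonGaussian Literature.MathematicalPhysics.QuantumFieldTheory.QCDField.glue ∧ (∀ f g : Fin Nf, f ≠ g → T.IsNontrivial (Literature.MathematicalPhysics.QuantumFieldTheory.QCDField.pseudoRe f g))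 ∧ ∃ Δ > 0, T.HasMassGap Δ ∧ (reg.scheme m z shift).HasLatticeMassGap Δ) :
    RobustYangMillsHandover := fun hX =>
  ⟨qcdOf_of_subs h₁ h₂ h₃ hX 2 (Or.inl rfl), qcdOf_of_subs h₁ h₂ h₃ hX 3 (Or.inr rfl)⟩

end Summit.QuantumFields.QCD.Theorems.RobustYangMillsHandover.Split
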